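/-
Copyright (c) 2026 the pub-hodgecm-mathlib formalisation cell (harness21).  Prover seat hodgecm-mathlib-R90-C10-p08 (g3), R90-TF SLAB section S1 «Ch10-local» (base
R90-C10), h413 = `stmt-HodgeConjecture-24833`; line «U4Keys :182 — THE WILD CORNER (S-W-Rb)», brick (W-2g) «CONDUCTOR PARITY» (P-WILD-1 merge item (M-a) = §0 (P′) of the
memo of record `R90/R90-C10-p06/g4/P-WILD-1.v2.md` ae6d6510; my draft `R90/R90-C10-p08/g3/P-WILD-1.v1.md` 12ec90d2 §1; cross-read `P-WILD-1.xread.v1.md` 2e58408c (B1)).  2026-09-05.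
-/
import Summits.HodgeConjecture.HodgeConjecture.Theorems.R90S1WildUnitNormIndex        -- ★ p865073 (W-2, this seat): `apply_eq_one_of_fixed_of_valued_sub_one_le` (conductor ≤ d); brings the `hD` ∕ `conjLocal` currency and the one-place dictionary
import Literature.NumberTheory.LocalFields.WildQuadraticDatumNormFibreValues             -- ★ (LH4-p12 lineage): `WildQuadraticDatum.exists_fixed_v_sub_le_varpi` (every integer of `L_w` is within `|ϖ|` of a σ-fixed one: `k_E = k_F`)
import HarnessLib

/-!
# R90-TF S1 «Ch10-local» ∕ U4Keys :182, THE WILD CORNER — brick (W-2g): CONDUCTOR PARITY in Branch B at a ramified place: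
# if `χ₁` is trivial on the units `≡ 1 (mod ϖ_w^{2i+1})` and `i ≥ d`, it is trivial on the units `≡ 1 (mod ϖ_w^{2i})` — so in (R-b) the `E`-conductor is `2δ + 1` or EVEN

Cell `pub/hodgecm-mathlib`, crux H413 = `stmt-HodgeConjecture-24833`, route of record `HCCMUnconditional` (no route verbs); lane `--supports stmt-HodgeConjecture-24833 --as helper`,
count-neutral.  THEOREMS ONLY (no `def`, no `instance`, no `notation`, no named-fact hypothesis, no `sorry`); ★ ∕ Literature-only imports.  NOT THE PAYER of :182 ∕ (S-W).

THE MATHEMATICS (P-WILD-1 (P′); Serre, *Corps locaux* I §6 Prop. 18, XV §2).  `w ∣ v` non-split and ramified, datum `hD : IsRamifiedQuadraticDatum σ_w ϖ d t` (`d` = different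
exponent).  Since `k_E = k_F`, every class of the `k`-line `𝔭_w^{2i} ∕ 𝔭_w^{2i+1}` has a σ-FIXED representative: for `a` with `|a| ≤ |ϖ|^{2i}` there is a fixed `f`, `|f| ≤ |ϖ|^{2i}`,
with `|a − f| ≤ |ϖ|^{2i+1}` (★ `exists_fixed_v_sub_le_varpi` applied to `a∕π^i`, `π := ϖ·σϖ` the fixed element of order two).  Hence
`U^{(2i)} = (1 + 𝔭_F^{i})·U^{(2i+1)}`, and `χ₁(1 + f) = 1` for the fixed principal unit `1 + f` as soon as `2i ≥ 2d − 1` — ★ (W-2) `apply_eq_one_of_fixed_of_valued_sub_one_le`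
(conductor of `χ₁|_{U_F}` is at most `d`, from `hB` alone).  So:
* **`apply_eq_one_of_cond_odd_level`**: `hB`, `hD`, `d ≤ i`, `χ₁ ≡ 1` on `{u : |u_{w′} − 1| ≤ |ϖ|^{2i+1}}` ⟹ `χ₁ ≡ 1` on `{u : |u_{w′} − 1| ≤ |ϖ|^{2i}}` (the organ's `hcond` letter at level
  `2i+1` implies it at level `2i`).
* **`not_cond_sharp_odd_level`**: consequently the conductor of `χ₁` is never an odd number `2i + 1` with `i ≥ d` — with ★ (W-2c) §4 (`cond ≥ 2δ + 1` in (R-b)):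
  `cond_E χ₁ ∈ {2δ + 1} ∪ {2d, 2d + 2, …}` (the tame parity (P) «`n` even», ★ p863739, is the case `d = 1`, `n ≥ 2`).
CONSEQUENCES (memo of record §0 ∕ type side `WILD-COVER-GAP.v1.md`): the «`n` odd `≥ 2δ+3`» cases of the wild shell law are vacuous in Branch B; the X∪Z witness cover at `e_Rb`,
`k = 2δ`, which closes only for odd `n ≥ 2δ + 3`, therefore ALWAYS leaves its gap line in (S-W-Rb).
HONEST LABEL.  HC_CM is proved only modulo the 7 printed citations (2 remaining named inputs: hLiu418 = `stmt-HodgeConjecture-24832`, h413 = `stmt-HodgeConjecture-24833`) until rung 0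
closes; (W-2g) is infrastructure of the (S-W) wild roads and pays NO socket; (S-W) stays OPEN; REL ≠ ★ ≠ BUILT.

## References
* [Serre1979] J.-P. Serre, *Local Fields*, GTM 67 (1979), Ch. I §6 Prop. 18 (`𝒪_E = 𝒪_F ⊕ 𝒪_Fϖ`), Ch. V §3 Cor. 3, Ch. XV §2 (conductor of the norm residue symbol).
* [Keys1984] D. Keys, *Principal series representations of special unitary groups over local fields*, Compositio Math. 51 (1984), §5, §7 Theorem (2) (d) p. 126.
* [Rogawski1990] J. D. Rogawski, *Automorphic Representations of Unitary Groups in Three Variables*, Ann. of Math. Stud. 123 (1990), §12.2 (2) p. 173.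
-/

set_option autoImplicit false
-- the mandated namespace has the single-problem summit's repeated segment (`HodgeConjecture.HodgeConjecture`)
set_option linter.dupNamespace false

noncomputable section

open NumberField IsDedekindDomain
open scoped Valued
open Literature.NumberTheory.Automorphic Literature.NumberTheory.Automorphic.UnitaryGroup
open Literature.NumberTheory.Automorphic.UnitaryThreeFourFrame (IsRamifiedQuadraticDatum)
open Literature.NumberTheory.LocalFields
open Summit.HodgeConjecture.HodgeConjecture.Cruxes.H413
open Summit.HodgeConjecture.HodgeConjecture.R90.S1.WildUnitNormIndex

namespace Summit.HodgeConjecture.HodgeConjecture.R90.S1.WildConductorParity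

variable (L : Type) [Field L] [NumberField L] [IsCMField L] (v : HeightOneSpectrum (𝓞 ↥(maximalRealSubfield L)))
  (w : PlacesOver L v) (hw : IsCMField.complexConj L • w.1 = w.1)

/-! ## §1 One-place transport: lift of a unit of `L_w` to a `σ`-compatible unit of `R` -/

include hw in
/-- Lift of an element `g` of `L_w` with `|g| = 1` to a unit `G` of `R` with `G_w = g`; if `σ_w g = g` then `σ G = G` (one place above `v`). [cite: Serre1979, Ch. II §3] -/
private theorem exists_unit_apply_eq_of_valued_eq_one {g : w.1.adicCompletion L} (hg : Valued.v g = 1)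
    (hσg : galAdicCompletionMap (L := L) (IsCMField.complexConj L) hw g = g) :
    ∃ G : (LocalRing L v)ˣ, (G : LocalRing L v) w = g ∧
      Units.map (conjLocal L (IsCMField.complexConj L) v : LocalRing L v →* LocalRing L v) G = G := by
  classical
  haveI : Algebra.IsQuadraticExtension ↥(maximalRealSubfield L) L := IsCMField.isQuadraticExtension L
  haveI : Subsingleton (PlacesOver L v) :=
    PlacesOver.subsingleton_of_smul_eq (IsCMField.complexConj L) (IsCMField.complexConj_ne_one L) w hw
  have hg0 : g ≠ 0 := fun h0 => by rw [h0, map_zero] at hg; exact zero_ne_one hg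
  set y₀ : LocalRing L v := Function.update 0 w g with hy₀
  have hy₀w : y₀ w = g := by rw [hy₀, Function.update_self]
  have hne : y₀ ≠ 0 := fun h => hg0 (by rw [← hy₀w, h, Pi.zero_apply])
  have hu : IsUnit y₀ := (F0P3cStCharTSLocalRingNormDictionary.isUnit_iff_ne_zero_localRing L v w hw y₀).2 hne
  refine ⟨hu.unit, by rw [hu.unit_spec, hy₀w], Units.ext ?_⟩
  refine (LocalRing.eq_iff_apply_eq (IsCMField.complexConj L) (IsCMField.complexConj_ne_one L) w hw _ _).2 ?_
  rw [Units.coe_map, MonoidHom.coe_coe, conjLocal_apply_eq_of_smul_eq (IsCMField.complexConj L) (IsCMField.complexConj_ne_one L) v w hw,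
    hu.unit_spec, hy₀w, hσg]

/-! ## §2 Fixed representatives of the even graded pieces and the parity step -/

include hw in
/-- **FIXED APPROXIMATION AT AN EVEN LEVEL**: for `a ∈ L_w` with `|a| ≤ |ϖ|^{2i}` there is a `σ_w`-fixed `f` with `|f| ≤ |ϖ|^{2i}` and `|a − f| ≤ |ϖ|^{2i+1}` — ★
`exists_fixed_v_sub_le_varpi` (every integer is within `|ϖ|` of a fixed one, `k_E = k_F`) applied to `a∕πⁱ`, `π := ϖ·σϖ`. [cite: Serre1979, Ch. I §6 Prop. 18] -/
theorem exists_fixed_near_of_valued_le_even {ϖ : w.1.adicCompletion L} {d t : ℕ}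
    (hD : IsRamifiedQuadraticDatum (galAdicCompletionMap (L := L) (IsCMField.complexConj L) hw) ϖ d t) (i : ℕ)
    {a : w.1.adicCompletion L} (ha : Valued.v a ≤ Valued.v ϖ ^ (2 * i)) :
    ∃ f : w.1.adicCompletion L, galAdicCompletionMap (L := L) (IsCMField.complexConj L) hw f = f ∧
      Valued.v f ≤ Valued.v ϖ ^ (2 * i) ∧ Valued.v (a - f) ≤ Valued.v ϖ ^ (2 * i + 1) := by
  have hσσ := hD.1; have hvσ := hD.2.1; have hϖ := hD.2.2.1
  have hϖ0 : ϖ ≠ 0 := fun h0 => by rw [h0, map_zero] at hϖ; exact WithZero.zero_ne_coe hϖ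
  -- the fixed element `π = ϖ·σϖ` of order two
  set π : w.1.adicCompletion L := ϖ * galAdicCompletionMap (L := L) (IsCMField.complexConj L) hw ϖ with hπ
  have hσπ : galAdicCompletionMap (L := L) (IsCMField.complexConj L) hw π = π := by rw [hπ, map_mul, hσσ, mul_comm]
  have hvπ : Valued.v π = Valued.v ϖ ^ 2 := by rw [hπ, map_mul, hvσ, sq]
  have hπ0 : π ≠ 0 := mul_ne_zero hϖ0 ((map_ne_zero _).2 hϖ0)
  have hvπi : Valued.v (π ^ i) = Valued.v ϖ ^ (2 * i) := by rw [map_pow, hvπ, ← pow_mul]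
  have hπi0 : π ^ i ≠ 0 := pow_ne_zero i hπ0
  -- `a∕πⁱ` is an integer; approximate it by a fixed one
  have hu : Valued.v (a / π ^ i) ≤ 1 := by
    rw [map_div₀, hvπi, div_le_one₀ (by rw [← hvπi]; exact (Valuation.pos_iff _).2 hπi0)]
    exact ha
  obtain ⟨α, hσα, hα1, hαa⟩ := WildQuadraticDatum.exists_fixed_v_sub_le_varpi hD hu
  refine ⟨α * π ^ i, by rw [map_mul, map_pow, hσα, hσπ], ?_, ?_⟩
  · rw [map_mul, hvπi]; exact mul_le_of_le_one_left' hα1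
  · have e : a - α * π ^ i = (a / π ^ i - α) * π ^ i := by field_simp
    rw [e, map_mul, hvπi, pow_succ, mul_comm (Valued.v ϖ ^ (2 * i))]
    exact mul_le_mul' hαa le_rfl

include hw in
/-- **THE PARITY STEP**: Branch B (`hB`), the place datum `hD`, `d ≤ i`, and `χ₁ ≡ 1` on the units `u` with `|u_{w′} − 1| ≤ |ϖ|^{2i+1}` (the organ's `hcond` letter at level
`2i + 1`) ⟹ `χ₁ ≡ 1` on the units with `|u_{w′} − 1| ≤ |ϖ|^{2i}`.  Proof: `u_w = 1 + a`, pick a fixed `f ≡ a (mod ϖ^{2i+1})` with `|f| ≤ |ϖ|^{2i}`; the fixed principal unit `G = 1 + f`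
has `χ₁ G = 1` (★ (W-2) conductor `≤ d`, as `2i ≥ 2d − 1`), and `u·G⁻¹ ≡ 1 (mod ϖ^{2i+1})` is killed by `hcond`. [cite: Serre1979, Ch. XV §2] [cite: Keys1984, §7 Theorem (2) (d) p. 126] -/
theorem apply_eq_one_of_cond_odd_level (χ₁ : (LocalRing L v)ˣ →* ℂˣ)
    (hB : ∀ u : (LocalRing L v)ˣ, (∀ w' : PlacesOver L v, Valued.v ((u : LocalRing L v) w') = 1) →
      χ₁ (u * Units.map (conjLocal L (IsCMField.complexConj L) v : LocalRing L v →* LocalRing L v) u) = 1)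
    {ϖ : w.1.adicCompletion L} {d t : ℕ} (hD : IsRamifiedQuadraticDatum (galAdicCompletionMap (L := L) (IsCMField.complexConj L) hw) ϖ d t)
    {i : ℕ} (hi : d ≤ i)
    (hcond : ∀ u : (LocalRing L v)ˣ, (∀ w' : PlacesOver L v, Valued.v (((u : LocalRing L v) w') - 1) ≤ Valued.v ϖ ^ (2 * i + 1)) → χ₁ u = 1)
    (u : (LocalRing L v)ˣ) (hu : ∀ w' : PlacesOver L v, Valued.v (((u : LocalRing L v) w') - 1) ≤ Valued.v ϖ ^ (2 * i)) : χ₁ u = 1 := by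
  haveI : Algebra.IsQuadraticExtension ↥(maximalRealSubfield L) L := IsCMField.isQuadraticExtension L
  haveI : Subsingleton (PlacesOver L v) :=
    PlacesOver.subsingleton_of_smul_eq (IsCMField.complexConj L) (IsCMField.complexConj_ne_one L) w hw
  have hϖ : Valued.v ϖ = WithZero.exp (-1 : ℤ) := hD.2.2.1
  have hd1 : 1 ≤ d := hD.2.2.2.2.2.1
  have hlt : ∀ n : ℕ, 1 ≤ n → Valued.v ϖ ^ n < 1 := fun n hn => by
    rw [WildQuadraticDatum.v_varpi_pow hϖ n, ← WithZero.exp_zero, WithZero.exp_lt_exp]; omega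
  -- the fixed approximation of `a := u_w − 1`
  obtain ⟨f, hσf, hf, haf⟩ := exists_fixed_near_of_valued_le_even L v w hw hD i (hu w)
  have hf1 : Valued.v f < 1 := lt_of_le_of_lt hf (hlt (2 * i) (by omega))
  have hg1 : Valued.v (1 + f) = 1 := Valuation.map_one_add_of_lt _ hf1
  have hσg : galAdicCompletionMap (L := L) (IsCMField.complexConj L) hw (1 + f) = 1 + f := by rw [map_add, map_one, hσf]
  obtain ⟨G, hGw, hσG⟩ := exists_unit_apply_eq_of_valued_eq_one L v w hw hg1 hσg
  -- `χ₁ G = 1`: a fixed principal unit at level `2i ≥ 2d − 1`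
  have hχG : χ₁ G = 1 := by
    refine apply_eq_one_of_fixed_of_valued_sub_one_le L v w hw χ₁ hB hD hσG (show 2 * d - 1 ≤ 2 * i by omega) ?_
    rw [hGw, add_sub_cancel_left]; exact hf
  -- `χ₁ (u·G⁻¹) = 1`: `u_w∕(1+f) − 1 = (a − f)∕(1 + f)` has level `2i + 1`
  have hg0 : (1 + f) ≠ 0 := fun h0 => by rw [h0, map_zero] at hg1; exact zero_ne_one hg1
  have hχH : χ₁ (u * G⁻¹) = 1 := by
    refine hcond (u * G⁻¹) fun w' => ?_
    obtain rfl : w' = w := Subsingleton.elim _ _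
    have e : ((u * G⁻¹ : (LocalRing L v)ˣ) : LocalRing L v) w' - 1 = ((u : LocalRing L v) w' - 1 - f) / (1 + f) := by
      rw [Units.val_mul, Pi.mul_apply, Units.val_inv_eq_inv_val, Pi.inv_apply, hGw]
      field_simp
      ring
    rw [e, map_div₀, hg1, div_one]
    exact haf
  calc χ₁ u = χ₁ (u * G⁻¹ * G) := by rw [inv_mul_cancel_right]
    _ = 1 := by rw [map_mul, hχH, hχG, one_mul]

include hw in
/-- **THE CONDUCTOR IS NEVER A SHARP ODD LEVEL `2i + 1` WITH `i ≥ d`**: under `hB`, `hD`, `d ≤ i`, it is impossible that `χ₁ ≡ 1` at level `2i + 1` while some unit `u₁` with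
`|u₁,w′ − 1| ≤ |ϖ|^{2i}` has `χ₁ u₁ ≠ 1` (the organ's sharpness letters `hcond` ∕ `u₁ hu₁ hχu₁` cannot sit at an odd level `2i+1 ≥ 2d+1`).  With ★ (W-2c) `two_mul_pred_add_one_le_of_cond`
(`cond ≥ 2δ+1` in (R-b)) this is the wild parity (P′): `cond_E χ₁ ∈ {2δ+1} ∪ {2d, 2d+2, …}`. [cite: Serre1979, Ch. XV §2] [cite: Keys1984, §5; §7 Theorem (2) (d) p. 126]
[cite: Rogawski1990, §12.2 (2) p. 173] -/
theorem not_cond_sharp_odd_level (χ₁ : (LocalRing L v)ˣ →* ℂˣ)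
    (hB : ∀ u : (LocalRing L v)ˣ, (∀ w' : PlacesOver L v, Valued.v ((u : LocalRing L v) w') = 1) →
      χ₁ (u * Units.map (conjLocal L (IsCMField.complexConj L) v : LocalRing L v →* LocalRing L v) u) = 1)
    {ϖ : w.1.adicCompletion L} {d t : ℕ} (hD : IsRamifiedQuadraticDatum (galAdicCompletionMap (L := L) (IsCMField.complexConj L) hw) ϖ d t)
    {i : ℕ} (hi : d ≤ i)
    (hcond : ∀ u : (LocalRing L v)ˣ, (∀ w' : PlacesOver L v, Valued.v (((u : LocalRing L v) w') - 1) ≤ Valued.v ϖ ^ (2 * i + 1)) → χ₁ u = 1)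
    (u₁ : (LocalRing L v)ˣ) (hu₁ : ∀ w' : PlacesOver L v, Valued.v (((u₁ : LocalRing L v) w') - 1) ≤ Valued.v ϖ ^ (2 * i)) (hχu₁ : χ₁ u₁ ≠ 1) : False :=
  hχu₁ (apply_eq_one_of_cond_odd_level L v w hw χ₁ hB hD hi hcond u₁ hu₁)

end Summit.HodgeConjecture.HodgeConjecture.R90.S1.WildConductorParity

end
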